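import Literature.NumberTheory.Sieve.GreenTao2008CorrelationCore
import Literature.NumberTheory.Sieve.CoprimeMoebiusLogSums
import HarnessLib

/-!
# Green–Tao (2008), Proposition 9.6 up to constants — the local data for shifts `θ_i(x) = W(x + h_i) + 1`

Third brick of the tree's elementary proof of the `O_m(1)`-form of B. Green, T. Tao,
Ann. of Math. 167 (2008), Proposition 9.6 (see `GreenTao2008CorrelationCore` for the plan). Here the
abstract core is specialised to the system of the correlation condition: the primes
`P = {p ≤ N : p ∤ W}` (`N = ⌊R⌋`), the local spaces `ℤ_p`, the indicators
`I_i(p, u) = 1[W(u + h_i) + 1 ≡ 0 (mod p)]`, the densities `a_p = 1/p`, and the weights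
`Λ(V) = μ(d) log(R/d)/log R`, `d = ∏_{p ∈ V} p ≤ R`. Contents:

* `sievePrimes N W` and the dictionary between sets of such primes and square-free numbers
  (`sum_finsetSubtype_eq_sum_squarefreeOf`: `U ↦ ∏_{p ∈ U} p` is a bijection onto
  `CFZ.squarefreeOf`);
* `corrInd W h i p u` and its local statistics at a prime `p ∤ W`: density exactly `1/p`
  (`expect_corrInd`), products of indicators have expectation `≤ 1/p` (`expect_prod_corrInd_le`), and
  vanish when two indices `i ≠ j` with `p ∤ h_i − h_j` occur (`expect_prod_corrInd_eq_zero`) — the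
  hypotheses of the local lemmas of `GreenTao2008CorrelationCore`;
* `corrCoef R d = μ(d) log(R/d)/log R · 1_{d ≤ R}` and `lamSet`, and THE BOUND ON THE DIAGONALISING
  COEFFICIENTS (`abs_zCoeff_lamSet_le`):
  `|z(T)| ≤ 7 (W/φ(W)) (∏_{p ∈ T} p/(p−1)) / log R`, by identifying `z(T)` with
  `μ(f) (log R)⁻¹ Σ_{g ≤ R/f, (g, fW) = 1} μ(g)/g · log((R/f)/g)`, `f = ∏_{p∈T} p`, and quoting
  `CoprimeMoebius.abs_sum_coprime_moebius_div_mul_log_le'`.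

## References
* B. Green, T. Tao, Ann. of Math. (2) 167 (2008), Proposition 9.6, Lemma 10.1. [cite: GreenTaoAnnals2008]
-/

noncomputable section

open Finset Real
open scoped BigOperators ArithmeticFunction.Moebius

namespace Literature.NumberTheory.Sieve.GreenTao2008

/-! ### The primes of the model -/

/-- The primes `p ≤ N` not dividing `W` (the only primes that can divide a `θ_i = W(·) + 1` and a
`d ≤ R`, `N = ⌊R⌋`). [cite: GreenTaoAnnals2008, Section 10 (p. 531)] -/
def sievePrimes (N W : ℕ) : Finset ℕ := (Nat.primesBelow (N + 1)).filter fun p => ¬ p ∣ W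

/-- Membership in `sievePrimes`. [cite: GreenTaoAnnals2008, Section 10 (p. 531)] -/
theorem mem_sievePrimes {N W p : ℕ} : p ∈ sievePrimes N W ↔ p.Prime ∧ p ≤ N ∧ ¬ p ∣ W := by
  unfold sievePrimes
  rw [mem_filter, Nat.mem_primesBelow, Nat.lt_succ_iff]
  tauto

/-- The elements of `sievePrimes` are primes. [cite: GreenTaoAnnals2008, Section 10 (p. 531)] -/
theorem prime_of_mem_sievePrimes {N W p : ℕ} (hp : p ∈ sievePrimes N W) : p.Prime :=
  (mem_sievePrimes.1 hp).1

/-- `sievePrimes` consists of primes (the hypothesis shape of the `CFZ` lemmas).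
[cite: GreenTaoAnnals2008, Section 10 (p. 531)] -/
theorem sievePrimes_prime (N W : ℕ) : ∀ p ∈ sievePrimes N W, p.Prime := fun _ hp => prime_of_mem_sievePrimes hp

/-- The primes of the model are nonzero (so that `ZMod p` is finite). [folklore] -/
instance neZero_coe_sievePrimes {N W : ℕ} (p : sievePrimes N W) : NeZero ((p : ℕ)) :=
  ⟨(prime_of_mem_sievePrimes p.2).ne_zero⟩

/-- The primes of the model are prime, as a `Fact` (so that `ZMod p` is a field). [folklore] -/
theorem fact_prime_coe_sievePrimes {N W : ℕ} (p : sievePrimes N W) : Fact (p : ℕ).Prime :=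
  ⟨prime_of_mem_sievePrimes p.2⟩

/-! ### Sets of primes versus square-free numbers -/

section Dictionary

variable {P : Finset ℕ}

/-- The square-free number `∏_{p ∈ U} p` attached to a set `U` of primes of `P`. [folklore] -/
def setProd (U : Finset P) : ℕ := ∏ q ∈ U, (q : ℕ)

/-- Unfolding `setProd`. [folklore] -/
theorem setProd_def (U : Finset P) : setProd U = ∏ q ∈ U, (q : ℕ) := rfl

/-- `setProd U` as a product over the image set of naturals. [folklore] -/
theorem setProd_eq_prod_map (U : Finset P) :
    setProd U = ∏ n ∈ U.map (Function.Embedding.subtype _), n := by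
  rw [setProd_def, prod_map]
  rfl

/-- `setProd U ≠ 0` for a set of primes. [folklore] -/
theorem setProd_pos (hP : ∀ p ∈ P, p.Prime) (U : Finset P) : 0 < setProd U :=
  prod_pos fun q _ => (hP q q.2).pos

/-- The prime factors of `setProd U` are `U`. [folklore] -/
theorem primeFactors_setProd (hP : ∀ p ∈ P, p.Prime) (U : Finset P) :
    (setProd U).primeFactors = U.map (Function.Embedding.subtype _) := by
  rw [setProd_eq_prod_map]
  exact Nat.primeFactors_prod fun n hn => by
    obtain ⟨q, -, rfl⟩ := mem_map.1 hn
    exact hP q q.2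

/-- `setProd U` is square-free. [folklore] -/
theorem squarefree_setProd (hP : ∀ p ∈ P, p.Prime) (U : Finset P) : Squarefree (setProd U) := by
  rw [setProd_eq_prod_map]
  exact CFZ.squarefree_prod_of_primes fun n hn => by
    obtain ⟨q, -, rfl⟩ := mem_map.1 hn
    exact hP q q.2

/-- `setProd U ∈ CFZ.squarefreeOf P`. [folklore] -/
theorem setProd_mem_squarefreeOf (hP : ∀ p ∈ P, p.Prime) (U : Finset P) :
    setProd U ∈ CFZ.squarefreeOf P := by
  refine (CFZ.mem_squarefreeOf hP).2 ⟨squarefree_setProd hP U, ?_⟩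
  rw [primeFactors_setProd hP]
  intro n hn
  obtain ⟨q, -, rfl⟩ := mem_map.1 hn
  exact q.2

/-- For a prime `p ∈ P`: `p ∣ setProd U ↔ p ∈ U`. [folklore] -/
theorem coe_dvd_setProd_iff (hP : ∀ p ∈ P, p.Prime) (U : Finset P) (p : P) :
    (p : ℕ) ∣ setProd U ↔ p ∈ U :=
  CFZ.prime_dvd_prod_primes_iff hP U

/-- The set of primes of `P` dividing `d`. [folklore] -/
def primeSet (P : Finset ℕ) (d : ℕ) : Finset P := univ.filter fun p => (p : ℕ) ∣ d

/-- Membership in `primeSet`. [folklore] -/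
theorem mem_primeSet {d : ℕ} {p : P} : p ∈ primeSet P d ↔ (p : ℕ) ∣ d := by
  unfold primeSet; simp

/-- `primeSet (setProd U) = U`. [folklore] -/
theorem primeSet_setProd (hP : ∀ p ∈ P, p.Prime) (U : Finset P) : primeSet P (setProd U) = U := by
  ext p
  rw [mem_primeSet, coe_dvd_setProd_iff hP]

/-- `setProd (primeSet d) = d` for `d ∈ CFZ.squarefreeOf P`. [folklore] -/
theorem setProd_primeSet (hP : ∀ p ∈ P, p.Prime) {d : ℕ} (hd : d ∈ CFZ.squarefreeOf P) :
    setProd (primeSet P d) = d := by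
  obtain ⟨T, hT, rfl⟩ := mem_image.1 hd
  have hTP : T ⊆ P := mem_powerset.1 hT
  have hTp : ∀ n ∈ T, n.Prime := fun n hn => hP n (hTP hn)
  -- `primeSet (∏ T) = T` read in the subtype
  have hset : primeSet P (∏ n ∈ T, n) = T.subtype (· ∈ P) := by
    ext p
    rw [mem_primeSet, mem_subtype, (Nat.prime_iff.1 (hP p p.2)).dvd_finsetProd_iff]
    constructor
    · rintro ⟨n, hn, hdvd⟩
      have : (p : ℕ) = n := (Nat.prime_dvd_prime_iff_eq (hP p p.2) (hTp n hn)).1 hdvd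
      rw [this]; exact hn
    · intro hp; exact ⟨p, hp, dvd_rfl⟩
  rw [hset, setProd_eq_prod_map, subtype_map_of_mem fun n hn => hTP hn]

/-- **The dictionary**: summing over sets of primes of `P` is summing over the square-free numbers
all of whose prime factors lie in `P`: `∑_{U} F(∏_{p ∈ U} p) = ∑_{d ∈ squarefreeOf P} F(d)`.
[folklore] -/
theorem sum_finsetSubtype_eq_sum_squarefreeOf {M : Type*} [AddCommMonoid M] (hP : ∀ p ∈ P, p.Prime)
    (F : ℕ → M) : ∑ U : Finset P, F (setProd U) = ∑ d ∈ CFZ.squarefreeOf P, F d :=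
  sum_nbij' (fun U => setProd U) (fun d => primeSet P d) (fun U _ => setProd_mem_squarefreeOf hP U)
    (fun _ _ => mem_univ _) (fun U _ => primeSet_setProd hP U) (fun _ hd => setProd_primeSet hP hd)
    (fun _ _ => rfl)

/-- Disjoint sets of primes give coprime numbers. [folklore] -/
theorem coprime_setProd_of_disjoint (hP : ∀ p ∈ P, p.Prime) {U V : Finset P} (h : Disjoint U V) :
    (setProd U).Coprime (setProd V) := by
  rw [setProd_def, setProd_def, Nat.coprime_prod_left_iff]
  intro p hp
  rw [Nat.coprime_prod_right_iff]
  intro q hq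
  have hne : (p : ℕ) ≠ q := fun hpq => disjoint_left.1 h hp (by rwa [Subtype.ext hpq])
  exact (Nat.coprime_primes (hP p p.2) (hP q q.2)).2 hne

/-- `setProd (T ∪ U) = setProd T * setProd U` for disjoint `T, U`. [folklore] -/
theorem setProd_union {T U : Finset P} (h : Disjoint T U) : setProd (T ∪ U) = setProd T * setProd U := by
  rw [setProd_def, setProd_def, setProd_def, prod_union h]

end Dictionary

/-! ### The local indicators and their statistics -/

section Indicators

variable {m : ℕ}

/-- The local indicator `I_i(p, u) = 1[W(u + h_i) + 1 = 0 in ℤ_p]` (`θ_i(u) ≡ 0 (mod p)`).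
[cite: GreenTaoAnnals2008, Section 10 (local factors, (10.3))] -/
def corrInd (W : ℕ) (h : Fin m → ℤ) (i : Fin m) (p : ℕ) (u : ZMod p) : ℝ :=
  if (W : ZMod p) * (u + (h i : ZMod p)) + 1 = 0 then 1 else 0

/-- Unfolding `corrInd`. [cite: GreenTaoAnnals2008, Section 10 (local factors, (10.3))] -/
theorem corrInd_def (W : ℕ) (h : Fin m → ℤ) (i : Fin m) (p : ℕ) (u : ZMod p) :
    corrInd W h i p u = if (W : ZMod p) * (u + (h i : ZMod p)) + 1 = 0 then 1 else 0 := rfl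

/-- `I_i(p, u) ∈ {0, 1}`. [cite: GreenTaoAnnals2008, Section 10 (local factors, (10.3))] -/
theorem corrInd_eq_zero_or_one (W : ℕ) (h : Fin m → ℤ) (i : Fin m) (p : ℕ) (u : ZMod p) :
    corrInd W h i p u = 0 ∨ corrInd W h i p u = 1 := by
  rw [corrInd_def]; split_ifs <;> simp

/-- `0 ≤ I ≤ 1`. [cite: GreenTaoAnnals2008, Section 10 (local factors, (10.3))] -/
theorem corrInd_nonneg_le_one (W : ℕ) (h : Fin m → ℤ) (i : Fin m) (p : ℕ) (u : ZMod p) :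
    0 ≤ corrInd W h i p u ∧ corrInd W h i p u ≤ 1 := by
  rcases corrInd_eq_zero_or_one W h i p u with h0 | h1
  · rw [h0]; norm_num
  · rw [h1]; norm_num

/-- The congruence `W(u + h) + 1 ≡ 0 (mod p)` has exactly one solution `u = -(W⁻¹ + h)` when
`p ∤ W` is prime. [cite: GreenTaoAnnals2008, Lemma 10.1] -/
theorem filter_corr_eq_singleton {p W : ℕ} [Fact p.Prime] (hpW : ¬ p ∣ W) (c : ZMod p) :
    (univ : Finset (ZMod p)).filter (fun u => (W : ZMod p) * (u + c) + 1 = 0) = {-((W : ZMod p)⁻¹ + c)} := by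
  have hW : (W : ZMod p) ≠ 0 := fun h0 => hpW ((ZMod.natCast_eq_zero_iff W p).1 h0)
  ext u
  simp only [mem_filter, mem_univ, true_and, mem_singleton]
  constructor
  · intro hu
    have h1 : u + c = -(W : ZMod p)⁻¹ := by
      have : (W : ZMod p) * (u + c) = -1 := by linear_combination hu
      field_simp
      linear_combination this
    linear_combination h1
  · intro hu
    rw [hu]
    field_simp
    ring

/-- **Density exactly `1/p`**: `E_u I_i(p, u) = 1/p` for a prime `p ∤ W`.
[cite: GreenTaoAnnals2008, Lemma 10.1] -/
theorem expect_corrInd {p W : ℕ} [Fact p.Prime] (hpW : ¬ p ∣ W) (h : Fin m → ℤ) (i : Fin m) :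
    𝔼 u : ZMod p, corrInd W h i p u = 1 / p := by
  simp only [corrInd_def]
  rw [expect_eq_sum_div_card, sum_boole, filter_corr_eq_singleton hpW, card_singleton, card_univ,
    ZMod.card]
  simp

/-- Nonempty products of indicators have expectation `≤ 1/p`. [cite: GreenTaoAnnals2008, Lemma 10.1] -/
theorem expect_prod_corrInd_le {p W : ℕ} [Fact p.Prime] (hpW : ¬ p ∣ W) (h : Fin m → ℤ)
    {U : Finset (Fin m ⊕ Fin m)} (hU : U.Nonempty) :
    𝔼 u : ZMod p, ∏ v ∈ U, corrInd W h (CFZ.slotIdx v) p u ≤ 1 / p := by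
  obtain ⟨v₀, hv₀⟩ := hU
  rw [← expect_corrInd hpW h (CFZ.slotIdx v₀)]
  refine expect_le_expect fun u _ => ?_
  rw [← mul_prod_erase U _ hv₀]
  have h0 := corrInd_nonneg_le_one W h (CFZ.slotIdx v₀) p u
  calc corrInd W h (CFZ.slotIdx v₀) p u * ∏ v ∈ U.erase v₀, corrInd W h (CFZ.slotIdx v) p u
      ≤ corrInd W h (CFZ.slotIdx v₀) p u * 1 :=
        mul_le_mul_of_nonneg_left (prod_le_one (fun v _ => (corrInd_nonneg_le_one W h _ p u).1)
          fun v _ => (corrInd_nonneg_le_one W h _ p u).2) h0.1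
    _ = _ := mul_one _

/-- Two indicators `I_i, I_j` with `p ∤ h_i - h_j` are disjointly supported (for a prime `p ∤ W`).
[cite: GreenTaoAnnals2008, Lemma 10.1] -/
theorem corrInd_mul_corrInd_eq_zero {p W : ℕ} [Fact p.Prime] (hpW : ¬ p ∣ W) (h : Fin m → ℤ)
    {i j : Fin m} (hij : ¬ (p : ℤ) ∣ h i - h j) (u : ZMod p) :
    corrInd W h i p u * corrInd W h j p u = 0 := by
  have hW : (W : ZMod p) ≠ 0 := fun h0 => hpW ((ZMod.natCast_eq_zero_iff W p).1 h0)
  rw [corrInd_def, corrInd_def]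
  split_ifs with h1 h2
  · exfalso
    apply hij
    rw [← ZMod.intCast_zmod_eq_zero_iff_dvd]
    push_cast
    have : (W : ZMod p) * ((h i : ZMod p) - h j) = 0 := by linear_combination h1 - h2
    rcases mul_eq_zero.1 this with h3 | h3
    · exact absurd h3 hW
    · exact h3
  all_goals simp

/-- Products of indicators involving two indices `i ≠ j` with `p ∤ h_i − h_j` vanish in expectation.
[cite: GreenTaoAnnals2008, Lemma 10.1] -/
theorem expect_prod_corrInd_eq_zero {p W : ℕ} [Fact p.Prime] (hpW : ¬ p ∣ W) (h : Fin m → ℤ)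
    (hgen : ∀ i j : Fin m, i ≠ j → ¬ (p : ℤ) ∣ h i - h j)
    {U : Finset (Fin m ⊕ Fin m)} (hU : ∃ v ∈ U, ∃ v' ∈ U, CFZ.slotIdx v ≠ CFZ.slotIdx v') :
    𝔼 u : ZMod p, ∏ v ∈ U, corrInd W h (CFZ.slotIdx v) p u = 0 := by
  obtain ⟨v, hv, v', hv', hne⟩ := hU
  have hvv' : v ≠ v' := fun heq => hne (by rw [heq])
  refine expect_eq_zero fun u _ => ?_
  have hz := corrInd_mul_corrInd_eq_zero hpW h (hgen _ _ hne) u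
  rcases mul_eq_zero.1 hz with h0 | h0
  · exact prod_eq_zero hv h0
  · exact prod_eq_zero hv' h0

end Indicators

/-! ### The weights and the bound on the diagonalising coefficients -/

section Weights

/-- The normalised Goldston–Yıldırım coefficient `c(d) = μ(d) log(R/d)/log R` for `d ≤ R` (and `0`
beyond `R`), so that `Λ_R(n) = log R · ∑_{d ∣ n} c(d)` and `|c| ≤ 1`.
[cite: GreenTaoAnnals2008, Definition 9.2] -/
def corrCoef (R : ℝ) (d : ℕ) : ℝ :=
  if (d : ℝ) ≤ R then (μ d : ℝ) * Real.log (R / d) / Real.log R else 0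

/-- Unfolding `corrCoef`. [cite: GreenTaoAnnals2008, Definition 9.2] -/
theorem corrCoef_def (R : ℝ) (d : ℕ) :
    corrCoef R d = if (d : ℝ) ≤ R then (μ d : ℝ) * Real.log (R / d) / Real.log R else 0 := rfl

/-- `|c(d)| ≤ 1` (for `R > 1`: `0 ≤ log(R/d) ≤ log R` when `1 ≤ d ≤ R`, and `μ(0) = 0`).
[cite: GreenTaoAnnals2008, Definition 9.2] -/
theorem abs_corrCoef_le_one {R : ℝ} (hR : 1 < R) (d : ℕ) : |corrCoef R d| ≤ 1 := by
  rw [corrCoef_def]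
  split_ifs with hd
  · rcases Nat.eq_zero_or_pos d with rfl | hd0
    · simp
    · have hd1 : (1 : ℝ) ≤ d := by exact_mod_cast hd0
      have hlogR : 0 < Real.log R := Real.log_pos hR
      have hl0 : 0 ≤ Real.log (R / d) := Real.log_nonneg ((one_le_div (by linarith)).2 hd)
      have hl1 : Real.log (R / d) ≤ Real.log R := by
        rw [Real.log_div (by linarith) (by linarith)]
        linarith [Real.log_nonneg hd1]
      have hμ : |(μ d : ℝ)| ≤ 1 := by exact_mod_cast ArithmeticFunction.abs_moebius_le_one
      rw [abs_div, abs_mul, abs_of_nonneg hl0, abs_of_pos hlogR, div_le_one hlogR]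
      calc |(μ d : ℝ)| * Real.log (R / d) ≤ 1 * Real.log R := mul_le_mul hμ hl1 hl0 zero_le_one
        _ = Real.log R := one_mul _
  · simp

/-- `c(d) = 0` unless `d` is square-free. [cite: GreenTaoAnnals2008, Definition 9.2] -/
theorem corrCoef_eq_zero_of_not_squarefree (R : ℝ) {d : ℕ} (hd : ¬Squarefree d) : corrCoef R d = 0 := by
  rw [corrCoef_def, ArithmeticFunction.moebius_eq_zero_of_not_squarefree hd]
  simp

/-- The weights of the model: `Λ(V) = c(∏_{p ∈ V} p)`. [cite: GreenTaoAnnals2008, Definition 9.2] -/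
def lamSet (R : ℝ) {P : Finset ℕ} (V : Finset P) : ℝ := corrCoef R (setProd V)

/-- Unfolding `lamSet`. [cite: GreenTaoAnnals2008, Definition 9.2] -/
theorem lamSet_def (R : ℝ) {P : Finset ℕ} (V : Finset P) : lamSet R V = corrCoef R (setProd V) := rfl

/-- The shifted logarithmic Möbius weight `G_y(g) = μ(g)/g · log(y/g) · 1_{g ≤ y}`. [folklore] -/
def logMoebiusWeight (y : ℝ) (g : ℕ) : ℝ :=
  if (g : ℝ) ≤ y then (μ g : ℝ) / g * Real.log (y / g) else 0

/-- Unfolding `logMoebiusWeight`. [folklore] -/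
theorem logMoebiusWeight_def (y : ℝ) (g : ℕ) :
    logMoebiusWeight y g = if (g : ℝ) ≤ y then (μ g : ℝ) / g * Real.log (y / g) else 0 := rfl

/-- **Multiplicativity step**: for coprime `f, g ≥ 1`,
`c(fg) · (1/g) = (μ(f)/log R) · G_{R/f}(g)`. [cite: GreenTaoAnnals2008, Section 10] -/
theorem corrCoef_mul_div_eq {R : ℝ} {f g : ℕ} (hf : 0 < f) (hfg : f.Coprime g) :
    corrCoef R (f * g) / g = (μ f : ℝ) / Real.log R * logMoebiusWeight (R / f) g := by
  have hf0 : (0 : ℝ) < f := by exact_mod_cast hf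
  rw [corrCoef_def, logMoebiusWeight_def]
  have hiff : ((f * g : ℕ) : ℝ) ≤ R ↔ (g : ℝ) ≤ R / f := by
    rw [le_div_iff₀ hf0]; push_cast; rw [mul_comm]
  by_cases hg : (g : ℝ) ≤ R / f
  · rw [if_pos (hiff.2 hg), if_pos hg,
      ArithmeticFunction.isMultiplicative_moebius.map_mul_of_coprime hfg]
    push_cast
    rw [div_div, show ((f : ℝ) * g) = (f * g : ℝ) from rfl]
    field_simp
  · rw [if_neg (fun h => hg (hiff.1 h)), if_neg hg]
    simp

variable {N W : ℕ}

/-- **Step 1–3 of the identification of `z(T)`**: for `T` a set of primes of `P = sievePrimes N W`,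
`z(T) = (μ(f)/log R) ∑_{d ∈ squarefreeOf P, (d, f) = 1} G_{R/f}(d)`, `f = ∏_{p ∈ T} p`.
[cite: GreenTaoAnnals2008, Section 10] -/
theorem zCoeff_lamSet_eq (R : ℝ) (T : Finset (sievePrimes N W)) :
    zCoeff (lamSet R) (fun p => 1 / (p : ℝ)) univ T =
      (μ (setProd T) : ℝ) / Real.log R *
        ∑ d ∈ (CFZ.squarefreeOf (sievePrimes N W)).filter (fun d => d.Coprime (setProd T)),
          logMoebiusWeight (R / setProd T) d := by
  classical
  have hP := sievePrimes_prime N W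
  set f : ℕ := setProd T with hf
  have hf0 : 0 < f := setProd_pos hP T
  -- Step 1: reindex `V ⊇ T` by `U = V \ T`
  have h1 : zCoeff (lamSet R) (fun p => 1 / (p : ℝ)) univ T =
      ∑ U ∈ univ.filter (fun U : Finset (sievePrimes N W) => Disjoint T U),
        corrCoef R (setProd (T ∪ U)) * ∏ p ∈ U, (1 / (p : ℝ)) := by
    rw [zCoeff_def]
    refine sum_nbij' (fun V => V \ T) (fun U => T ∪ U) ?_ ?_ ?_ ?_ ?_
    · intro V _
      exact mem_filter.2 ⟨mem_univ _, disjoint_sdiff⟩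
    · intro U hU
      exact mem_filter.2 ⟨mem_powerset.2 (subset_univ _), subset_union_left⟩
    · intro V hV
      exact union_sdiff_of_subset (mem_filter.1 hV).2
    · intro U hU
      exact union_sdiff_cancel_left (mem_filter.1 hU).2
    · intro V hV
      rw [lamSet_def, union_sdiff_of_subset (mem_filter.1 hV).2]
  -- Step 2: multiplicativity
  have h2 : ∀ U ∈ univ.filter (fun U : Finset (sievePrimes N W) => Disjoint T U),
      corrCoef R (setProd (T ∪ U)) * ∏ p ∈ U, (1 / (p : ℝ)) =
        (μ f : ℝ) / Real.log R * logMoebiusWeight (R / f) (setProd U) := by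
    intro U hU
    have hdisj : Disjoint T U := (mem_filter.1 hU).2
    rw [setProd_union hdisj, ← corrCoef_mul_div_eq hf0 (coprime_setProd_of_disjoint hP hdisj)]
    rw [div_eq_mul_inv]
    congr 1
    rw [setProd_def, Nat.cast_prod, ← prod_inv_distrib]
    exact prod_congr rfl fun p _ => one_div _
  rw [h1, sum_congr rfl h2, ← mul_sum]
  congr 1
  -- Step 3: disjointness is coprimality, then the dictionary
  have h3 : ∑ U ∈ univ.filter (fun U : Finset (sievePrimes N W) => Disjoint T U),
      logMoebiusWeight (R / f) (setProd U) =
        ∑ U : Finset (sievePrimes N W),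
          (if (setProd U).Coprime f then logMoebiusWeight (R / f) (setProd U) else 0) := by
    rw [sum_filter]
    refine sum_congr rfl fun U _ => ?_
    have hiff : Disjoint T U ↔ (setProd U).Coprime f := by
      constructor
      · intro h; exact coprime_setProd_of_disjoint hP h.symm
      · intro h
        rw [disjoint_left]
        intro p hpT hpU
        have hp1 : (p : ℕ) ∣ setProd U := (coe_dvd_setProd_iff hP U p).2 hpU
        have hp2 : (p : ℕ) ∣ f := (coe_dvd_setProd_iff hP T p).2 hpT
        have h1 : (p : ℕ) ∣ Nat.gcd (setProd U) f := Nat.dvd_gcd hp1 hp2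
        rw [h.gcd_eq_one] at h1
        exact (hP p p.2).one_lt.ne' (Nat.dvd_one.1 h1)
    by_cases hd : Disjoint T U
    · rw [if_pos hd, if_pos (hiff.1 hd)]
    · rw [if_neg hd, if_neg (fun h => hd (hiff.2 h))]
  rw [h3, sum_finsetSubtype_eq_sum_squarefreeOf hP
    (fun d => if d.Coprime f then logMoebiusWeight (R / f) d else 0), ← sum_filter]

/-- **Step 4**: the sum of Step 3 is the coprime Möbius sum of `CoprimeMoebiusLogSums`:
for `f = ∏_{p∈T} p` (`T ⊆ sievePrimes N W`, `N = ⌊R⌋`),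
`∑_{d ∈ squarefreeOf P, (d,f)=1} G_{R/f}(d) = ∑_{g ≤ R/f, (g, fW) = 1} μ(g)/g · log((R/f)/g)`.
[cite: GreenTaoAnnals2008, Section 10] -/
theorem sum_logMoebiusWeight_eq {R : ℝ} (hR : 1 ≤ R) (hN : N = ⌊R⌋₊)
    (T : Finset (sievePrimes N W)) :
    ∑ d ∈ (CFZ.squarefreeOf (sievePrimes N W)).filter (fun d => d.Coprime (setProd T)),
        logMoebiusWeight (R / setProd T) d =
      ∑ g ∈ (Icc 1 ⌊R / setProd T⌋₊).filter (fun g => g.Coprime (setProd T * W)),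
        ((μ g : ℤ) : ℝ) / g * Real.log (R / setProd T / g) := by
  classical
  have hP := sievePrimes_prime N W
  set f : ℕ := setProd T with hf
  have hf0 : 0 < f := setProd_pos hP T
  have hf0' : (0 : ℝ) < f := by exact_mod_cast hf0
  set y : ℝ := R / f with hy
  set Y : ℕ := ⌊y⌋₊ with hY
  have hy0 : 0 ≤ y := div_nonneg (by linarith) hf0'.le
  have hYN : Y ≤ N := by
    rw [hY, hN]
    refine Nat.floor_le_floor ?_
    rw [hy, div_le_iff₀ hf0']
    have : (1 : ℝ) ≤ f := by exact_mod_cast hf0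
    nlinarith
  -- both sides are sums over the same finite set of square-free numbers
  have hset : (CFZ.squarefreeOf (sievePrimes N W)).filter (fun d => d.Coprime f ∧ d ≤ Y) =
      ((Icc 1 Y).filter (fun g => g.Coprime (f * W))).filter Squarefree := by
    ext d
    simp only [mem_filter, mem_Icc, CFZ.mem_squarefreeOf hP]
    constructor
    · rintro ⟨⟨hsq, hsub⟩, hcop, hdY⟩
      refine ⟨⟨⟨Nat.pos_of_ne_zero hsq.ne_zero, hdY⟩, Nat.Coprime.mul_right hcop ?_⟩, hsq⟩
      refine Nat.coprime_of_dvd fun k hk hkd hkW => ?_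
      have hk' : k ∈ sievePrimes N W := hsub (Nat.mem_primeFactors.2 ⟨hk, hkd, hsq.ne_zero⟩)
      exact (mem_sievePrimes.1 hk').2.2 hkW
    · rintro ⟨⟨⟨hd1, hdY⟩, hcop⟩, hsq⟩
      refine ⟨⟨hsq, fun q hq => ?_⟩, Nat.Coprime.coprime_mul_right_right hcop |> fun h => ?_, hdY⟩
      · have hqp := Nat.prime_of_mem_primeFactors hq
        have hqd := Nat.dvd_of_mem_primeFactors hq
        refine mem_sievePrimes.2 ⟨hqp, ?_, fun hqW => ?_⟩
        · exact le_trans (le_trans (Nat.le_of_dvd (by omega) hqd) hdY) hYN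
        · have h1 : q ∣ Nat.gcd d (f * W) := Nat.dvd_gcd hqd (dvd_mul_of_dvd_right hqW f)
          rw [hcop] at h1
          exact hqp.one_lt.ne' (Nat.dvd_one.1 h1)
      · exact Nat.Coprime.coprime_mul_right_right hcop
  -- the left-hand side restricted to `d ≤ Y`
  have hL : ∑ d ∈ (CFZ.squarefreeOf (sievePrimes N W)).filter (fun d => d.Coprime f), logMoebiusWeight y d =
      ∑ d ∈ (CFZ.squarefreeOf (sievePrimes N W)).filter (fun d => d.Coprime f ∧ d ≤ Y),
        (μ d : ℝ) / d * Real.log (y / d) := by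
    rw [← filter_filter, sum_filter (p := fun d => d ≤ Y)]
    refine sum_congr rfl fun d _ => ?_
    rw [logMoebiusWeight_def]
    have : (d : ℝ) ≤ y ↔ d ≤ Y := by rw [hY]; exact (Nat.le_floor_iff hy0).symm
    by_cases hd : d ≤ Y
    · rw [if_pos (this.2 hd), if_pos hd]
    · rw [if_neg (fun h => hd (this.1 h)), if_neg hd]
  -- the right-hand side restricted to square-free `g`
  have hRt : ∑ g ∈ (Icc 1 Y).filter (fun g => g.Coprime (f * W)), ((μ g : ℤ) : ℝ) / g * Real.log (y / g) =
      ∑ g ∈ ((Icc 1 Y).filter (fun g => g.Coprime (f * W))).filter Squarefree,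
        ((μ g : ℤ) : ℝ) / g * Real.log (y / g) := by
    symm
    refine sum_filter_of_ne fun g _ hne => ?_
    by_contra hsq
    apply hne
    rw [ArithmeticFunction.moebius_eq_zero_of_not_squarefree hsq]
    simp
  rw [hL, hRt, ← hset]

/-- `f/φ(f) = ∏_{p ∈ T} (1 - 1/p)⁻¹` for `f = ∏_{p ∈ T} p`. [folklore] -/
theorem setProd_div_totient_eq {P : Finset ℕ} (hP : ∀ p ∈ P, p.Prime) (T : Finset P) :
    (setProd T : ℝ) / (setProd T).totient = ∏ p ∈ T, (1 - 1 / (p : ℝ))⁻¹ := by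
  have hf0 : (0 : ℝ) < setProd T := by exact_mod_cast setProd_pos hP T
  rw [Literature.NumberTheory.LFunctions.MertensBound.totient_eq_mul_prod_one_sub_inv,
    primeFactors_setProd hP, prod_map]
  simp only [Function.Embedding.coe_subtype]
  rw [prod_inv_distrib, div_mul_eq_div_div, div_self hf0.ne', one_div]

/-- **The bound on the diagonalising coefficients**: for `P = sievePrimes ⌊R⌋ W`, `R > 1`, `W ≥ 1`,
and every set `T` of such primes,
`|z(T)| ≤ 7 (W/φ(W)) (∏_{p ∈ T} (1 − 1/p)⁻¹) / log R`.
Proof: `z(T) = (μ(f)/log R) Σ_{g ≤ R/f, (g, fW)=1} μ(g)/g · log((R/f)/g)` (`zCoeff_lamSet_eq`,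
`sum_logMoebiusWeight_eq`), the sum is at most `7 fW/φ(fW)` in size
(`CoprimeMoebius.abs_sum_coprime_moebius_div_mul_log_le'`), and `φ(fW) = φ(f)φ(W)`,
`f/φ(f) = ∏_{p∈T} p/(p−1)`. [cite: GreenTaoAnnals2008, Proposition 9.6 (weak form)] -/
theorem abs_zCoeff_lamSet_le {R : ℝ} (hR : 1 < R) (hW : W ≠ 0) (hN : N = ⌊R⌋₊)
    (T : Finset (sievePrimes N W)) :
    |zCoeff (lamSet R) (fun p => 1 / (p : ℝ)) univ T| ≤
      7 * ((W : ℝ) / W.totient) / Real.log R * ∏ p ∈ T, (1 - 1 / (p : ℝ))⁻¹ := by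
  have hP := sievePrimes_prime N W
  set f : ℕ := setProd T with hf
  have hf0 : 0 < f := setProd_pos hP T
  have hlogR : 0 < Real.log R := Real.log_pos hR
  rw [zCoeff_lamSet_eq, sum_logMoebiusWeight_eq hR.le hN, abs_mul]
  have hA := CoprimeMoebius.abs_sum_coprime_moebius_div_mul_log_le' (Nat.mul_ne_zero hf0.ne' hW) (R / f)
  -- `fW/φ(fW) = (f/φ(f)) (W/φ(W))`
  have hcopW : f.Coprime W := by
    refine Nat.coprime_of_dvd fun k hk hkf hkW => ?_
    have hk' : k ∈ (setProd T).primeFactors := Nat.mem_primeFactors.2 ⟨hk, hkf, hf0.ne'⟩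
    rw [primeFactors_setProd hP] at hk'
    obtain ⟨p, -, rfl⟩ := mem_map.1 hk'
    exact (mem_sievePrimes.1 p.2).2.2 hkW
  have hsplit : ((f * W : ℕ) : ℝ) / (f * W).totient = ((f : ℝ) / f.totient) * ((W : ℝ) / W.totient) := by
    rw [Nat.totient_mul hcopW]
    push_cast
    rw [mul_div_mul_comm]
  rw [hsplit, setProd_div_totient_eq hP] at hA
  have hμ : |(μ f : ℝ) / Real.log R| ≤ 1 / Real.log R := by
    rw [abs_div, abs_of_pos hlogR]
    exact div_le_div_of_nonneg_right (by exact_mod_cast ArithmeticFunction.abs_moebius_le_one) hlogR.le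
  have hX0 : 0 ≤ 7 * ((∏ p ∈ T, (1 - 1 / (p : ℝ))⁻¹) * ((W : ℝ) / W.totient)) := by
    have : (0 : ℝ) ≤ (f : ℝ) / f.totient := by positivity
    rw [← setProd_div_totient_eq hP]
    positivity
  calc |(μ f : ℝ) / Real.log R| *
        |∑ g ∈ (Icc 1 ⌊R / f⌋₊).filter (fun g => g.Coprime (f * W)), ((μ g : ℤ) : ℝ) / g * Real.log (R / f / g)|
      ≤ (1 / Real.log R) * (7 * ((∏ p ∈ T, (1 - 1 / (p : ℝ))⁻¹) * ((W : ℝ) / W.totient))) :=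
        mul_le_mul hμ hA (abs_nonneg _) (by positivity)
    _ = 7 * ((W : ℝ) / W.totient) / Real.log R * ∏ p ∈ T, (1 - 1 / (p : ℝ))⁻¹ := by
        field_simp

end Weights

end Literature.NumberTheory.Sieve.GreenTao2008
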